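import Literature.Analysis.FluidPDE.BiotSavartSupInterpolation
import Literature.Analysis.FluidPDE.NewtonPotentialGradient
import Literature.Analysis.FluidPDE.BiotSavartNewtonKernel
import Mathlib.Analysis.InnerProductSpace.EuclideanDist
import HarnessLib

/-!
# Crux `ExtremiserTransience.NearExtremalTransience` (stmt-NavierStokesRegularity-21883), line `extremiser_liouville`,
# stub K1b — potential-theoretic brick for the axial-truncation attack: `‖∇(Γ ∗ φ)(y)‖ ≤ A·R + √(∫φ²/(4πR))`

`--supports stmt-NavierStokesRegularity-21883` (helper).  Author: prover seat `ns-el-k1b` (g5).  Step (ii) of the attack on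
the JET alternative of the K1b residue (`Cruxes/NearExtremalTransience/Lines/extremiser_liouville_k1b_jet.md` §4) makes a
truncated deviation `G = g(ξ)χ_ρ(x_h)(v − c) ∈ C^∞_c` solenoidal with the tree's `classicalLerayProj G = G − ∇π[G]`,
`π[G] = Γ ∗ div G`, and pays the sup-norm excess `η = ‖∇π[G]‖_∞` in the convex-set KKT inequality
(`…ConstantSpeedConvexKKT`).  This file supplies the missing quantitative bound on that excess: for a test function
`φ ∈ C^∞_c(ℝ³)` (here `φ = div G`) with `|φ| ≤ A`,

* `inner_integral_smul_newtonGradVec_eq_fderiv` — `⟪∫ φ(x)∇Γ(y−x)dx, a⟫ = ∂ₐ(Γ ∗ φ)(y)`, `∇Γ(z) = (4π|z|³)⁻¹z`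
  (Gilbarg–Trudinger Lemma 4.1 via the tree's `fderiv_integral_newtonKernel_mul_apply`, `integral_newtonKernel_smul_fderiv_eq`);
* `biotSavart_smul_const_eq_cross_gradient` — `(K₃ ∗ (φ b))(y) = b × ∫ φ(x)∇Γ(y−x)dx` (`K₃(z)h = (4π|z|³)⁻¹ h × z`);
* **`norm_fderiv_newtonPotential_le_of_radius`** — `‖D(Γ ∗ φ)(y)‖ ≤ A R + √((∫φ²)/(4πR))` for every `R > 0`: the tree's
  near/far-field interpolation for Biot–Savart velocities (`norm_biotSavart_le_of_radius`, `BiotSavartSupInterpolation.lean`)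
  transferred through `b × ∇π` with `b` a unit vector orthogonal to `∇π(y)` (`exists_unit_orthogonal_fin_three`);
* tools: `norm_newtonGradVec_le`, `inner_newtonGradVec_eq_fderiv`, `biotSavartKernel_smul_eq_cross`, `integrable_smul_newtonGradVec`.

Standard potential theory (Majda–Bertozzi 2002 §4.1.3 (4.30), Lemma 4.5; Gilbarg–Trudinger Lemma 4.1); still missing for
step (ii): `D²π[G], D³π[G] ∈ L²` and `‖D²π[G]‖_∞ < ∞` (same representation with `φ = ∂div G`, `∂²div G`, plus far-field decay).

WHAT THIS IS NOT: K1b is NOT proved; nothing here proves NS regularity. [folklore]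
-/

noncomputable section

open MeasureTheory Set Function Filter Metric Real
open _root_.Topology
open scoped ENNReal NNReal InnerProductSpace RealInnerProductSpace

namespace Summit.NavierStokesRegularity.NavierStokesRegularity.Theorems

-- the problem directory repeats the summit name (`NavierStokesRegularity/NavierStokesRegularity`)
set_option linter.dupNamespace false

namespace ExtremiserLiouville

open Literature.Analysis.FluidPDE

variable {φ : EuclideanSpace ℝ (Fin 3) → ℝ}

/-! ### The vector kernel `∇Γ(z) = (4π|z|³)⁻¹ z` -/

/-- `‖(4π|z|³)⁻¹ z‖ ≤ (4π)⁻¹ |z|⁻²` (equality off the origin; both sides `0`-friendly at `z = 0`). [folklore] -/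
theorem norm_newtonGradVec_le (z : EuclideanSpace ℝ (Fin 3)) :
    ‖(4 * π * ‖z‖ ^ 3)⁻¹ • z‖ ≤ (4 * π)⁻¹ * (‖z‖ ^ 2)⁻¹ := by
  rcases eq_or_ne z 0 with rfl | hz
  · simp
  · have hzn : 0 < ‖z‖ := norm_pos_iff.2 hz
    rw [norm_smul, norm_inv, Real.norm_eq_abs, abs_of_pos (by positivity : 0 < 4 * π * ‖z‖ ^ 3)]
    rw [show (4 * π * ‖z‖ ^ 3)⁻¹ * ‖z‖ = (4 * π)⁻¹ * (‖z‖ ^ 2)⁻¹ by field_simp]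

/-- `⟪(4π|z|³)⁻¹ z, a⟫ = DΓ(z) a` (also at `z = 0`, where both sides vanish: `fderiv_newtonKernel_zero`). [folklore] -/
theorem inner_newtonGradVec_eq_fderiv (z a : EuclideanSpace ℝ (Fin 3)) :
    ⟪(4 * π * ‖z‖ ^ 3)⁻¹ • z, a⟫ = fderiv ℝ newtonKernel z a := by
  rcases eq_or_ne z 0 with rfl | hz
  · rw [fderiv_newtonKernel_zero]; simp
  · rw [fderiv_newtonKernel_apply hz, real_inner_smul_left, div_eq_inv_mul]

/-- The Biot–Savart kernel on a "vorticity" `c·b`: `K₃(z)(c b) = b × (c (4π|z|³)⁻¹ z)`. [folklore] -/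
theorem biotSavartKernel_smul_eq_cross (z b : EuclideanSpace ℝ (Fin 3)) (c : ℝ) :
    biotSavartKernel z (c • b) = crossCLM b (c • ((4 * π * ‖z‖ ^ 3)⁻¹ • z)) := by
  have h1 : crossCLM (c • b) z = c • crossCLM b z := by rw [map_smul]; rfl
  rw [biotSavartKernel, ← crossCLM_apply, h1, map_smul, map_smul, smul_smul, smul_smul]
  congr 1
  exact mul_comm _ _

/-! ### Integrability of `x ↦ φ(x) ∇Γ(y − x)` for a bounded compactly supported `φ` -/

/-- For `φ` continuous with compact support, `x ↦ φ(x) · (4π|y−x|³)⁻¹(y−x)` is integrable (majorant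
`(4π)⁻¹ A · 1_{|y−x|<ρ}|y−x|⁻²` with `supp φ ⊆ B(y, ρ)`, the tree's `integrable_kernelMajorant`). [folklore] -/
theorem integrable_smul_newtonGradVec (hφ : Continuous φ) (hφc : HasCompactSupport φ) (y : EuclideanSpace ℝ (Fin 3)) :
    Integrable (fun x => φ x • ((4 * π * ‖y - x‖ ^ 3)⁻¹ • (y - x))) volume := by
  obtain ⟨A, hA⟩ := hφ.bounded_above_of_compact_support hφc
  have hA0 : 0 ≤ A := (norm_nonneg _).trans (hA y)
  obtain ⟨R, hR⟩ : ∃ R : ℝ, tsupport φ ⊆ closedBall (0 : EuclideanSpace ℝ (Fin 3)) R :=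
    (hφc.isCompact.isBounded).subset_closedBall 0
  set ρ : ℝ := ‖y‖ + |R| + 1 with hρ
  -- measurability
  have hk : Measurable fun z : EuclideanSpace ℝ (Fin 3) => (4 * π * ‖z‖ ^ 3)⁻¹ • z :=
    ((measurable_const.mul (measurable_norm.pow_const 3)).inv).smul measurable_id
  have hmeas : AEStronglyMeasurable (fun x => φ x • ((4 * π * ‖y - x‖ ^ 3)⁻¹ • (y - x))) volume :=
    (hφ.measurable.smul (hk.comp (measurable_const.sub measurable_id))).aestronglyMeasurable
  refine ((((integrable_kernelMajorant ρ).comp_sub_left y).const_mul ((4 * π)⁻¹ * A))).mono' hmeas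
    (Eventually.of_forall fun x => ?_)
  by_cases hx : x ∈ tsupport φ
  · -- on the support: `|y − x| < ρ`
    have hxR : ‖x‖ ≤ |R| := (mem_closedBall_zero_iff.1 (hR hx)).trans (le_abs_self R)
    have hyx : ‖y - x‖ < ρ := by
      calc ‖y - x‖ ≤ ‖y‖ + ‖x‖ := norm_sub_le _ _
        _ < ρ := by rw [hρ]; linarith
    have hkm : kernelMajorant ρ (y - x) = (‖y - x‖ ^ 2)⁻¹ := by
      simp [kernelMajorant, indicator, hyx]
    rw [norm_smul, hkm, Real.norm_eq_abs]
    calc |φ x| * ‖(4 * π * ‖y - x‖ ^ 3)⁻¹ • (y - x)‖ ≤ A * ((4 * π)⁻¹ * (‖y - x‖ ^ 2)⁻¹) :=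
          mul_le_mul (by simpa [Real.norm_eq_abs] using hA x) (norm_newtonGradVec_le _) (norm_nonneg _) hA0
      _ = (4 * π)⁻¹ * A * (‖y - x‖ ^ 2)⁻¹ := by ring
  · rw [image_eq_zero_of_notMem_tsupport hx, zero_smul, norm_zero]
    exact mul_nonneg (by positivity) (kernelMajorant_nonneg _ _)

/-! ### The gradient of the Newtonian potential as the vector integral `∫ φ(x) ∇Γ(y − x) dx` -/

/-- **`⟪∫ φ(x) ∇Γ(y−x) dx, a⟫ = ∂ₐ(Γ ∗ φ)(y)`** for `φ ∈ C^∞_c` (Gilbarg–Trudinger Lemma 4.1: the derivative falls on `φ`,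
then integration by parts moves it onto the kernel — tree `fderiv_integral_newtonKernel_mul_apply`,
`integral_newtonKernel_smul_fderiv_eq`). [cite: GilbargTrudinger2001, Lemma 4.1] -/
theorem inner_integral_smul_newtonGradVec_eq_fderiv (hφ : ContDiff ℝ (⊤ : ℕ∞) φ) (hφc : HasCompactSupport φ)
    (y a : EuclideanSpace ℝ (Fin 3)) :
    ⟪∫ x, φ x • ((4 * π * ‖y - x‖ ^ 3)⁻¹ • (y - x)), a⟫ =
      fderiv ℝ (fun y => ∫ x, newtonKernel (y - x) * φ x) y a := by
  rw [fderiv_integral_newtonKernel_mul_apply hφ hφc y a]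
  have h2 := integral_newtonKernel_smul_fderiv_eq (F := ℝ) (contDiff_infty.1 hφ 1) hφc y a
  simp only [smul_eq_mul] at h2
  rw [h2, real_inner_comm, ← integral_inner (integrable_smul_newtonGradVec hφ.continuous hφc y) a]
  refine integral_congr_ae (Eventually.of_forall fun x => ?_)
  show ⟪a, φ x • ((4 * π * ‖y - x‖ ^ 3)⁻¹ • (y - x))⟫ = fderiv ℝ newtonKernel (y - x) a * φ x
  rw [real_inner_smul_right, real_inner_comm, inner_newtonGradVec_eq_fderiv, mul_comm]

/-- **`(K₃ ∗ (φ b))(y) = b × ∫ φ(x) ∇Γ(y − x) dx`**: the Biot–Savart velocity of the field `φ·b` (`b` a constant vector)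
is the cross product of `b` with the Newtonian gradient of `φ`. [folklore] -/
theorem biotSavart_smul_const_eq_cross_gradient (hφ : Continuous φ) (hφc : HasCompactSupport φ)
    (b y : EuclideanSpace ℝ (Fin 3)) :
    biotSavart (fun x => φ x • b) y = crossCLM b (∫ x, φ x • ((4 * π * ‖y - x‖ ^ 3)⁻¹ • (y - x))) := by
  rw [biotSavart, ← ContinuousLinearMap.integral_comp_comm _ (integrable_smul_newtonGradVec hφ hφc y)]
  exact integral_congr_ae (Eventually.of_forall fun x => biotSavartKernel_smul_eq_cross _ _ _)

/-! ### A unit vector orthogonal to a given vector of `ℝ³` -/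

/-- In `ℝ³` every vector has a unit vector orthogonal to it. [folklore] -/
theorem exists_unit_orthogonal_fin_three (g : EuclideanSpace ℝ (Fin 3)) :
    ∃ b : EuclideanSpace ℝ (Fin 3), ‖b‖ = 1 ∧ ⟪b, g⟫ = 0 := by
  -- a nonzero vector orthogonal to `g`
  obtain ⟨w, hw0, hwg⟩ : ∃ w : EuclideanSpace ℝ (Fin 3), w ≠ 0 ∧ ⟪w, g⟫ = 0 := by
    by_cases h : g 0 = 0 ∧ g 1 = 0
    · refine ⟨EuclideanSpace.single (0 : Fin 3) (1 : ℝ), ?_, ?_⟩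
      · intro h0
        have := congrArg (fun v : EuclideanSpace ℝ (Fin 3) => v 0) h0
        simp at this
      · rw [EuclideanSpace.inner_single_left]; simp [h.1]
    · refine ⟨(-(g 1)) • EuclideanSpace.single (0 : Fin 3) (1 : ℝ) + (g 0) • EuclideanSpace.single (1 : Fin 3) (1 : ℝ), ?_, ?_⟩
      · intro h0
        have e0 := congrArg (fun v : EuclideanSpace ℝ (Fin 3) => v 0) h0
        have e1 := congrArg (fun v : EuclideanSpace ℝ (Fin 3) => v 1) h0
        simp at e0 e1
        exact h ⟨e1, e0⟩
      · rw [inner_add_left, real_inner_smul_left, real_inner_smul_left, EuclideanSpace.inner_single_left,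
          EuclideanSpace.inner_single_left]
        simp; ring
  refine ⟨‖w‖⁻¹ • w, ?_, ?_⟩
  · rw [norm_smul, norm_inv, norm_norm, inv_mul_cancel₀ (norm_ne_zero_iff.2 hw0)]
  · rw [real_inner_smul_left, hwg, mul_zero]

/-! ### The interpolation bound -/

/-- **The `L^∞`–`L²` interpolation bound for the Newtonian gradient.**  For `φ ∈ C^∞_c(ℝ³)` with `|φ| ≤ A` and every
`R > 0`, `y ∈ ℝ³`:  `‖D(Γ ∗ φ)(y)‖ ≤ A·R + √((∫ φ²)/(4πR))` (near field `≤ AR`, far field by Cauchy–Schwarz against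
`∫_{|z|≥R}|z|⁻⁴ = 4π/R`; transferred from the tree's Biot–Savart bound `norm_biotSavart_le_of_radius` through
`(K₃ ∗ (φ b))(y) = b × ∇(Γ∗φ)(y)` with `b` a unit vector orthogonal to `∇(Γ∗φ)(y)`).
[cite: MajdaBertozziCUP2002, §4.1.3 (4.30), Lemma 4.5 (4.34)] -/
theorem norm_fderiv_newtonPotential_le_of_radius (hφ : ContDiff ℝ (⊤ : ℕ∞) φ) (hφc : HasCompactSupport φ)
    {A : ℝ} (hA : ∀ x, |φ x| ≤ A) {R : ℝ} (hR : 0 < R) (y : EuclideanSpace ℝ (Fin 3)) :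
    ‖fderiv ℝ (fun y => ∫ x, newtonKernel (y - x) * φ x) y‖ ≤ A * R + Real.sqrt ((∫ x, φ x ^ 2) / (4 * π * R)) := by
  set G : EuclideanSpace ℝ (Fin 3) := ∫ x, φ x • ((4 * π * ‖y - x‖ ^ 3)⁻¹ • (y - x)) with hG
  -- the gradient is represented by `G`
  have hrep : ∀ a, fderiv ℝ (fun y => ∫ x, newtonKernel (y - x) * φ x) y a = ⟪G, a⟫ := fun a =>
    (inner_integral_smul_newtonGradVec_eq_fderiv hφ hφc y a).symm
  have hbound0 : 0 ≤ A * R + Real.sqrt ((∫ x, φ x ^ 2) / (4 * π * R)) :=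
    add_nonneg (mul_nonneg ((abs_nonneg _).trans (hA y)) hR.le) (Real.sqrt_nonneg _)
  -- `‖G‖ ≤ bound` via the Biot–Savart velocity of `φ b`, `b ⊥ G` a unit vector
  have hGle : ‖G‖ ≤ A * R + Real.sqrt ((∫ x, φ x ^ 2) / (4 * π * R)) := by
    obtain ⟨b, hb1, hbG⟩ := exists_unit_orthogonal_fin_three G
    have hω : AEStronglyMeasurable (fun x => φ x • b) volume := (hφ.continuous.smul continuous_const).aestronglyMeasurable
    have hM : ∀ x, ‖φ x • b‖ ≤ A := fun x => by rw [norm_smul, hb1, mul_one, Real.norm_eq_abs]; exact hA x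
    have hI : Integrable (fun x => ‖φ x • b‖ ^ 2) volume := by
      have e : (fun x => ‖φ x • b‖ ^ 2) = fun x => φ x * φ x := by
        funext x; rw [norm_smul, hb1, mul_one, Real.norm_eq_abs, sq_abs, sq]
      rw [e]
      exact (hφ.continuous.mul hφ.continuous).integrable_of_hasCompactSupport hφc.mul_right
    have h := norm_biotSavart_le_of_radius hω hM hI hR y
    have e2 : (∫ x, ‖φ x • b‖ ^ 2) = ∫ x, φ x ^ 2 := by
      congr 1; funext x; rw [norm_smul, hb1, mul_one, Real.norm_eq_abs, sq_abs]
    have hcross : ‖cross b G‖ = ‖G‖ := by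
      rw [norm_cross, hb1, one_mul, (InnerProductGeometry.inner_eq_zero_iff_angle_eq_pi_div_two b G).1 hbG,
        Real.sin_pi_div_two, mul_one]
    rw [e2, biotSavart_smul_const_eq_cross_gradient hφ.continuous hφc b y, crossCLM_apply, ← hG, hcross] at h
    exact h
  refine ContinuousLinearMap.opNorm_le_bound _ hbound0 fun a => ?_
  rw [hrep a]
  exact (abs_real_inner_le_norm G a).trans (mul_le_mul_of_nonneg_right hGle (norm_nonneg _))

end ExtremiserLiouville

end Summit.NavierStokesRegularity.NavierStokesRegularity.Theorems

end
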